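import Summits.CriticalPhenomena.PercolationContinuityZ3.Theorems.PercNearOneGluingNoHeavyLowerTailMixCSHWorld
import Summits.CriticalPhenomena.PercolationContinuityZ3.Theorems.PercNearOneGluingNoHeavyLowerTailCovTauMetaA2Anti
import HarnessLib

/-!
# Mixed conditioned slack hierarchy — the "gain from an external gadget" world functional and the plain set-avoidance functional
# (the two new inputs of the META-A2 instance behind Lemma R⁻)

Definitions file (`--supports stmt-CriticalPhenomena-4575`), prover `prim-ineq-gen-7` (gen 9).  No named facts, no sorries, no `Prop` definitions.
Memo `prim-ineq-gen-7/PROOF-Q9-MIXED-CSH.md` §3.3 (Lemma R⁻, part (b)); blueprint §10 brick B3; write-up `Q9-WRITEUP.md` Lemma 5.5.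

In the `BHK2006` finite-sum framework on worlds `G[U]` (`CovTau.tfE / Yw / rest / sC`):
* `CovTau.gainF w K U' x g = E_{G[U' ∪ K]} g(C_x) − E_{G[U']} g(C_x)` — the GAIN of the owner `x` from an external gadget `K` (a vertex set outside
  the world); `≥ 0` for monotone `g` (`gainF_nonneg`, via `tfE_mono_world`).  It is NOT monotone in the world, but its source average is:
* `CovTau.Yw_gainF_single_le` — the one-source bound `Y_{gain}({u}) ≤ gain(U')` in every world `U'` disjoint from `K` (Markov at the cluster of `u`
  with the fresh region `E((U' ∖ C_u) ∪ K)` — `CovTau.sum_cond_sC_gen`, a version of prim-hp-4's `sum_cond_sC` with an arbitrary fresh vertex set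
  avoiding the cluster — then monotonicity of `g` in the world and positivity of the gain integrand); hence `Y_{gain}` is antitone in the
  source set (`Yw_gainF_antitone`, by `CovTau.Yw_antitone_of_le`).
* `CovTau.PavN w U Σ X N = μ_{G[U]}(Σ ⊆ U, Σ ↮ X ∪ N)` — the plain avoidance functional of a vertex set `Σ` (antitone in `N`, `≤ 1`), with its
  star decomposition `PavN_step` (BHK's identity (6) for the event `avoidAll`, `CovTau.avoidAll_step_sum`).
[cite: VandenbergHaggstromKahn2005, §1 identity (6) (p. 4), display (10) (pp. 7–8)] [cite: KozmaNitzan2024, Question 9 (§5.5 p. 36)]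
-/

noncomputable section

namespace Summit.CriticalPhenomena.PercolationContinuityZ3.Theorems.CovTau

open Literature.Probability.Percolation
open Literature.Probability.Percolation.BHK2006
open Literature.Probability.Percolation.DecisionTree (ind ind_of_mem ind_of_not_mem ind_nonneg)
open scoped Classical

variable {V : Type*}

/-! ### Clusters and worlds -/

/-- The set cluster of `N ⊆ U` in `G[U]` stays inside `U`. [folklore] -/
theorem sC_subset_of_subset {U : Finset V} {N : Set V} (hN : N ⊆ ↑U) (ω : Set (Sym2 V)) : sC U N ω ⊆ ↑U := by
  rintro u ⟨z, hz, hr⟩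
  by_cases hzu : z = u
  · exact hzu ▸ hN hz
  · obtain ⟨e, he, hue⟩ := ((reachable_iff_exists_mem_openEdgeCluster _ z u).1 hr).resolve_left (Ne.symm hzu)
    exact Finset.mem_coe.2 (((mem_openEdgeCluster_iff _ z e).1 he).1.2 u hue)

/-- **The cluster of `x` in `G[U]` is its cluster in the world `G[U ∖ C_N]` when `x ∉ C_N`.** [folklore] -/
theorem rC_rest_of_not_mem {U : Finset V} {N : Set V} {ω : Set (Sym2 V)} {x : V} (hx : x ∉ sC U N ω) :
    rC (rest U N ω) x ω = rC U x ω := by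
  ext e
  simp only [rC, mem_openEdgeCluster_iff, reach_rest_iff hx, Set.mem_inter_iff]
  constructor
  · rintro ⟨⟨hω, hE⟩, hd, hr⟩
    exact ⟨⟨hω, edgesIn_mono (rest_subset U N ω) hE⟩, hd, hr⟩
  · rintro ⟨⟨hω, hE⟩, hd, hr⟩
    refine ⟨⟨hω, fun a ha => mem_rest.2 ⟨hE a ha, fun haC => hx ?_⟩⟩, hd, hr⟩
    obtain ⟨z, hz, hza⟩ := haC
    exact ⟨z, hz, hza.trans (hr a ha).symm⟩

/-- `rC` is monotone in the world. [folklore] -/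
theorem rC_mono_world {U U' : Finset V} (h : U ⊆ U') (x : V) (ω : Set (Sym2 V)) : rC U x ω ⊆ rC U' x ω :=
  openEdgeCluster_mono (Set.inter_subset_inter_right ω (edgesIn_mono h)) x

/-- `rC U x` only reads the pairs inside `U`. [folklore] -/
theorem rC_inter_edgesIn (U : Finset V) (x : V) (ω : Set (Sym2 V)) : rC U x (ω ∩ edgesIn U) = rC U x ω := by
  simp only [rC, Set.inter_assoc, Set.inter_self]

/-- Deleting the pairs meeting a set `W` and keeping those inside `T ⊆ Wᶜ` is keeping those inside `T`. [folklore] -/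
theorem diff_meet_inter_edgesIn_of_disjoint {T : Finset V} {W : Set V} (hT : ∀ u ∈ T, u ∉ W) (ω : Set (Sym2 V)) :
    (ω \ {e | ∃ u ∈ e, u ∈ W}) ∩ edgesIn T = ω ∩ edgesIn T := by
  ext e
  constructor
  · rintro ⟨⟨hω, -⟩, hU⟩; exact ⟨hω, hU⟩
  · rintro ⟨hω, hU⟩
    exact ⟨⟨hω, fun ⟨u, hue, huW⟩ => hT u (hU u hue) huW⟩, hU⟩

variable [Fintype V]

/-- **Conditioning on the value of a set cluster, with an arbitrary fresh region avoiding it** (domain Markov property): for every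
`T : Set V → Finset V` with `T(W) ∩ W = ∅` and every `Φ`,
`Σ_ω weight(ω) Φ(C_N(ω), ω ∩ E(T(C_N ω))) = Σ_ω weight(ω) Σ_ω' weight(ω') Φ(C_N(ω), ω' ∩ E(T(C_N ω)))` (prim-hp-4's `sum_cond_sC` is `T(W) = U ∖ W`).
[cite: VandenbergHaggstromKahn2005, §1 pp. 7–8, display (10)] -/
theorem sum_cond_sC_gen (w : Sym2 V → ℝ) (hm : ∑ ω, weight w ω = 1) (U : Finset V) (N : Set V)
    (T : Set V → Finset V) (hT : ∀ W, ∀ u ∈ T W, u ∉ W) (Φ : Set V → Set (Sym2 V) → ℝ) :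
    ∑ ω, weight w ω * Φ (sC U N ω) (ω ∩ edgesIn (T (sC U N ω))) =
      ∑ ω, weight w ω * ∑ ω', weight w ω' * Φ (sC U N ω) (ω' ∩ edgesIn (T (sC U N ω))) := by
  have key : ∀ W : Set V,
      ∑ ω, (if sC U N ω = W then weight w ω * Φ W (ω ∩ edgesIn (T W)) else 0) =
      ∑ ω, (if sC U N ω = W then weight w ω * ∑ ω', weight w ω' * Φ W (ω' ∩ edgesIn (T W)) else 0) := by
    intro W
    set A : Set (Sym2 V) := {e | ∃ u ∈ e, u ∈ W} with hA
    set Ψ : Set (Sym2 V) → Set (Sym2 V) → ℝ := fun ζ η =>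
      if sC U N ζ = W then Φ W (η ∩ edgesIn (T W)) else 0 with hΨ
    have h1 : ∀ ω, (if sC U N ω = W then weight w ω * Φ W (ω ∩ edgesIn (T W)) else 0) =
        weight w ω * Ψ (ω ∩ A) (ω \ A) := by
      intro ω
      simp only [hΨ, hA, sC_inter_meet_eq_iff, diff_meet_inter_edgesIn_of_disjoint (hT W)]
      split_ifs <;> simp
    have h2 : ∀ ω ω', Ψ (ω ∩ A) (ω' \ A) = if sC U N ω = W then Φ W (ω' ∩ edgesIn (T W)) else 0 := by
      intro ω ω'
      simp only [hΨ, hA, sC_inter_meet_eq_iff, diff_meet_inter_edgesIn_of_disjoint (hT W)]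
    calc ∑ ω, (if sC U N ω = W then weight w ω * Φ W (ω ∩ edgesIn (T W)) else 0)
        = (∑ ω, weight w ω) * ∑ ω, weight w ω * Ψ (ω ∩ A) (ω \ A) := by rw [hm, one_mul]; simp_rw [h1]
      _ = ∑ ω, weight w ω * ∑ ω', weight w ω' * Ψ (ω ∩ A) (ω' \ A) := blockFubini w A Ψ
      _ = _ := by
          refine Finset.sum_congr rfl fun ω _ => ?_
          by_cases hc : sC U N ω = W <;> simp [h2, hc]
  have lhs : ∑ ω, weight w ω * Φ (sC U N ω) (ω ∩ edgesIn (T (sC U N ω))) =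
      ∑ ω, ∑ W : Set V, (if sC U N ω = W then weight w ω * Φ W (ω ∩ edgesIn (T W)) else 0) := by
    refine Finset.sum_congr rfl fun ω _ => ?_
    rw [Finset.sum_ite_eq Finset.univ (sC U N ω)]; simp
  have rhs : ∑ ω, weight w ω * ∑ ω', weight w ω' * Φ (sC U N ω) (ω' ∩ edgesIn (T (sC U N ω))) =
      ∑ ω, ∑ W : Set V, (if sC U N ω = W then
        weight w ω * ∑ ω', weight w ω' * Φ W (ω' ∩ edgesIn (T W)) else 0) := by
    refine Finset.sum_congr rfl fun ω _ => ?_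
    rw [Finset.sum_ite_eq Finset.univ (sC U N ω)]; simp
  rw [lhs, rhs, Finset.sum_comm]
  conv_rhs => rw [Finset.sum_comm]
  exact Finset.sum_congr rfl fun W _ => key W

/-! ### The gain of `x` from an external gadget -/

/-- `E_{G[U]} g(C_x)` is monotone in the world for a monotone `g`. [folklore] -/
theorem tfE_mono_world {w : Sym2 V → ℝ} (hw0 : ∀ e, 0 ≤ w e) (hw1 : ∀ e, w e ≤ 1) {U U' : Finset V} (h : U ⊆ U')
    (x : V) {g : Set (Sym2 V) → ℝ} (hg : Monotone g) : tfE w U x g ≤ tfE w U' x g :=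
  Finset.sum_le_sum fun ω _ => mul_le_mul_of_nonneg_left (hg (rC_mono_world h x ω)) (weight_nonneg hw0 hw1 ω)

/-- **The gain of the owner `x` from an external gadget `K`** in the world `U'`: `E_{G[U' ∪ K]} g(C_x) − E_{G[U']} g(C_x)` (memo §3.3: "f₁, the gain
of x from the external gadget K"; the gadget is the deleted cluster of a decoy). (transcription of the cell memo prim-ineq-gen-7 PROOF-Q9-MIXED-CSH.md §3.3) [folklore] -/
def gainF (w : Sym2 V → ℝ) (K : Finset V) (x : V) (g : Set (Sym2 V) → ℝ) (U' : Finset V) : ℝ :=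
  tfE w (U' ∪ K) x g - tfE w U' x g

/-- The gain is nonnegative for a monotone `g`. [folklore] -/
theorem gainF_nonneg {w : Sym2 V → ℝ} (hw0 : ∀ e, 0 ≤ w e) (hw1 : ∀ e, w e ≤ 1) (K : Finset V) (x : V)
    {g : Set (Sym2 V) → ℝ} (hg : Monotone g) (U' : Finset V) : 0 ≤ gainF w K x g U' :=
  sub_nonneg.2 (tfE_mono_world hw0 hw1 Finset.subset_union_left x hg)

/-- **The one-source bound for the gain functional**: in a world `U'` disjoint from the gadget, `Y_{gain}({u}) ≤ gain(U')` — by the Markov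
property at `C_u` with fresh region `(U' ∖ C_u) ∪ K`, `Y_{gain}({u}) = E[1{x↮u}(g(C_x[(U'∖C_u)∪K]) − g(C_x[U']))]`, and the integrand is at most
`g(C_x[U'∪K]) − g(C_x[U']) ≥ 0`. [cite: VandenbergHaggstromKahn2005, §1 pp. 7–8, display (10)] -/
theorem Yw_gainF_single_le (w : Sym2 V → ℝ) (hw0 : ∀ e, 0 ≤ w e) (hw1 : ∀ e, w e ≤ 1) (hm : ∑ ω, weight w ω = 1)
    (K : Finset V) (x : V) {g : Set (Sym2 V) → ℝ} (hg : Monotone g) {U' : Finset V} (hK : Disjoint U' K) (u : V) :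
    Yw w U' x (gainF w K x g) {u} ≤ gainF w K x g U' := by
  have hF0 := gainF_nonneg hw0 hw1 K x hg
  by_cases huU : u ∈ U'
  swap
  · -- `u ∉ U'`: `C_u = {u}`, the world is `U'` itself
    have hsC : ∀ ω : Set (Sym2 V), sC U' ({u} : Set V) ω = {u} := by
      intro ω
      refine Set.Subset.antisymm ?_ (subset_sC U' {u} ω)
      rintro a ⟨z, hz, hr⟩
      rw [Set.mem_singleton_iff] at hz
      subst hz
      rw [SimpleGraph.reachable_iff_reflTransGen] at hr
      rcases hr.cases_head with h | ⟨b, hab, -⟩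
      · subst h; exact Set.mem_singleton _
      · exact absurd (adj_iff.1 hab).2.1.1 huU
    have hrest : ∀ ω : Set (Sym2 V), rest U' ({u} : Set V) ω = U' := by
      intro ω; ext a
      rw [mem_rest, hsC]
      exact ⟨fun h => h.1, fun h => ⟨h, fun ha => huU ((Set.mem_singleton_iff.1 ha) ▸ h)⟩⟩
    unfold Yw
    calc ∑ ω, weight w ω * (gainF w K x g (rest U' {u} ω) * ind (rD U' x {u}) ω)
        ≤ ∑ ω, weight w ω * gainF w K x g U' := Finset.sum_le_sum fun ω _ => by
          rw [hrest]
          refine mul_le_mul_of_nonneg_left ?_ (weight_nonneg hw0 hw1 ω)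
          have := ind_le_one (rD U' x ({u} : Set V)) ω
          nlinarith [hF0 U', ind_nonneg (rD U' x ({u} : Set V)) ω]
      _ = gainF w K x g U' := by rw [← Finset.sum_mul, hm, one_mul]
  -- `u ∈ U'`: Markov at `C_u` with the fresh region `(U' ∖ C_u) ∪ K`
  set T : Set V → Finset V := fun W => (U'.filter fun a => a ∉ W) ∪ K with hT
  have hTW : ∀ W, W ⊆ ↑U' → ∀ a ∈ T W, a ∉ W := by
    intro W hW a ha haW
    rcases Finset.mem_union.1 ha with h | h
    · exact (Finset.mem_filter.1 h).2 haW
    · exact Finset.disjoint_left.1 hK (hW haW) h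
  have hsCU : ∀ ω : Set (Sym2 V), sC U' ({u} : Set V) ω ⊆ ↑U' := fun ω =>
    sC_subset_of_subset (by simpa using huU) ω
  -- Markov needs `T W ∩ W = ∅` only for the clusters that occur; modify `T` off those
  set T' : Set V → Finset V := fun W => if W ⊆ ↑U' then T W else ∅ with hT'def
  have hT' : ∀ W, ∀ a ∈ T' W, a ∉ W := by
    intro W a ha
    by_cases hW : W ⊆ ↑U'
    · have ha' : a ∈ T W := by simpa only [hT'def, if_pos hW] using ha
      exact hTW W hW a ha'
    · have ha' : a ∈ (∅ : Finset V) := by simpa only [hT'def, if_neg hW] using ha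
      exact absurd ha' (Finset.notMem_empty a)
  have hT'eq : ∀ ω : Set (Sym2 V), T' (sC U' ({u} : Set V) ω) = rest U' {u} ω ∪ K := by
    intro ω
    show (if sC U' ({u} : Set V) ω ⊆ ↑U' then T (sC U' ({u} : Set V) ω) else ∅) = _
    rw [if_pos (hsCU ω)]; rfl
  -- (1) the `U' ∪ K`-part of `Y`: Markov, then monotonicity in the world
  have hxind : ∀ ω : Set (Sym2 V), ind {W : Set V | x ∉ W} (sC U' ({u} : Set V) ω) = ind (rD U' x {u}) ω := by
    intro ω
    by_cases h : x ∈ sC U' ({u} : Set V) ω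
    · rw [ind_of_not_mem (show sC U' ({u} : Set V) ω ∉ {W : Set V | x ∉ W} from fun h' => h' h),
        ind_of_not_mem (fun h' => ((not_mem_sC_iff U' {u} ω x).2 h') h)]
    · rw [ind_of_mem (show sC U' ({u} : Set V) ω ∈ {W : Set V | x ∉ W} from h), ind_of_mem ((not_mem_sC_iff U' {u} ω x).1 h)]
  have markov := sum_cond_sC_gen w hm U' ({u} : Set V) T' hT'
    (fun W η => ind {W : Set V | x ∉ W} W * g (rC (T' W) x η))
  have e1 : ∑ ω, weight w ω * (tfE w (rest U' {u} ω ∪ K) x g * ind (rD U' x {u}) ω) =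
      ∑ ω, weight w ω * (ind (rD U' x {u}) ω * g (rC (rest U' {u} ω ∪ K) x ω)) := by
    refine (Eq.trans ?_ markov.symm).trans ?_
    · refine Finset.sum_congr rfl fun ω _ => ?_
      rw [hxind, hT'eq]
      congr 1
      rw [tfE, Finset.sum_mul]
      exact Finset.sum_congr rfl fun η _ => by rw [rC_inter_edgesIn]; ring
    · refine Finset.sum_congr rfl fun ω _ => ?_
      rw [hxind, hT'eq, rC_inter_edgesIn]
  -- (2) the `U'`-part of `Y`: Markov in `U'` itself (`T W = U' ∖ W`), and `C_x[U' ∖ C_u] = C_x[U']` off `C_u`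
  have markov2 := sum_cond_sC w hm U' ({u} : Set V) (fun W η => ind {W : Set V | x ∉ W} W * g (rC (U'.filter fun a => a ∉ W) x η))
  have e2 : ∑ ω, weight w ω * (tfE w (rest U' {u} ω) x g * ind (rD U' x {u}) ω) =
      ∑ ω, weight w ω * (ind (rD U' x {u}) ω * g (rC U' x ω)) := by
    refine (Eq.trans ?_ markov2.symm).trans ?_
    · refine Finset.sum_congr rfl fun ω _ => ?_
      rw [hxind, ← rest_eq_filter]
      congr 1
      rw [tfE, Finset.sum_mul]
      exact Finset.sum_congr rfl fun η _ => by rw [rC_inter_edgesIn]; ring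
    · refine Finset.sum_congr rfl fun ω _ => ?_
      rw [hxind, ← rest_eq_filter, rC_inter_edgesIn]
      by_cases hx : x ∈ sC U' ({u} : Set V) ω
      · rw [ind_of_not_mem (fun h' => ((not_mem_sC_iff U' {u} ω x).2 h') hx), zero_mul, zero_mul]
      · rw [rC_rest_of_not_mem hx]
  -- assemble
  have hsplit : Yw w U' x (gainF w K x g) {u} =
      ∑ ω, weight w ω * (tfE w (rest U' {u} ω ∪ K) x g * ind (rD U' x {u}) ω) -
        ∑ ω, weight w ω * (tfE w (rest U' {u} ω) x g * ind (rD U' x {u}) ω) := by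
    rw [Yw, ← Finset.sum_sub_distrib]
    exact Finset.sum_congr rfl fun ω _ => by rw [gainF]; ring
  rw [hsplit, e1, e2, ← Finset.sum_sub_distrib, gainF, tfE, tfE, ← Finset.sum_sub_distrib]
  refine Finset.sum_le_sum fun ω _ => ?_
  have hwω := weight_nonneg hw0 hw1 ω
  have hmono1 : g (rC (rest U' {u} ω ∪ K) x ω) ≤ g (rC (U' ∪ K) x ω) :=
    hg (rC_mono_world (Finset.union_subset_union (rest_subset U' {u} ω) le_rfl) x ω)
  have hmono2 : g (rC U' x ω) ≤ g (rC (U' ∪ K) x ω) := hg (rC_mono_world Finset.subset_union_left x ω)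
  have hi0 := ind_nonneg (rD U' x ({u} : Set V)) ω
  have hi1 := ind_le_one (rD U' x ({u} : Set V)) ω
  have key : ind (rD U' x ({u} : Set V)) ω * (g (rC (rest U' {u} ω ∪ K) x ω) - g (rC U' x ω)) ≤
      g (rC (U' ∪ K) x ω) - g (rC U' x ω) := by nlinarith [mul_nonneg hi0 (sub_nonneg.2 hmono1)]
  nlinarith [mul_le_mul_of_nonneg_left key hwω]

/-- **`Y_{gain}` is antitone in the source set** in every world `U` disjoint from the gadget. [cite: VandenbergHaggstromKahn2005, §1 pp. 7–8] -/
theorem Yw_gainF_antitone (w : Sym2 V → ℝ) (hw0 : ∀ e, 0 ≤ w e) (hw1 : ∀ e, w e ≤ 1) (hm : ∑ ω, weight w ω = 1)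
    (K : Finset V) (x : V) {g : Set (Sym2 V) → ℝ} (hg : Monotone g) {U : Finset V} (hK : Disjoint U K)
    {N N' : Set V} (hNN' : N ⊆ N') (hN'U : N' ⊆ ↑U) :
    Yw w U x (gainF w K x g) N' ≤ Yw w U x (gainF w K x g) N :=
  Yw_antitone_of_le w hw0 hw1 hm x (gainF w K x g) U
    (fun _ hU' u => Yw_gainF_single_le w hw0 hw1 hm K x hg (Finset.disjoint_of_subset_left hU' hK) u) hNN' hN'U

/-! ### The plain avoidance functional of a vertex set -/

/-- `P_X(N) = μ_{G[U]}(Σ ⊆ U, Σ ↮ X ∪ N)` — the plain avoidance probability of the vertex set `Σ` (memo §3.3: `⟨f₂⟩_N`).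
(transcription of the cell memo prim-ineq-gen-7 PROOF-Q9-MIXED-CSH.md §3.3) [folklore] -/
def PavN (w : Sym2 V → ℝ) (U : Finset V) (Sig : Finset V) (X : Set V) (N : Set V) : ℝ :=
  ∑ ω, weight w ω * ind (avoidAll U Sig (X ∪ N)) ω

/-- `P_X(N) ≥ 0`. [folklore] -/
theorem PavN_nonneg {w : Sym2 V → ℝ} (hw0 : ∀ e, 0 ≤ w e) (hw1 : ∀ e, w e ≤ 1) (U Sig : Finset V) (X N : Set V) :
    0 ≤ PavN w U Sig X N :=
  Finset.sum_nonneg fun ω _ => mul_nonneg (weight_nonneg hw0 hw1 ω) (ind_nonneg _ _)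

/-- `P_X(N) ≤ 1`. [folklore] -/
theorem PavN_le_one {w : Sym2 V → ℝ} (hw0 : ∀ e, 0 ≤ w e) (hw1 : ∀ e, w e ≤ 1) (hm : ∑ ω, weight w ω = 1)
    (U Sig : Finset V) (X N : Set V) : PavN w U Sig X N ≤ 1 := by
  unfold PavN
  calc ∑ ω, weight w ω * ind (avoidAll U Sig (X ∪ N)) ω ≤ ∑ ω, weight w ω * 1 :=
        Finset.sum_le_sum fun ω _ => mul_le_mul_of_nonneg_left (ind_le_one _ _) (weight_nonneg hw0 hw1 ω)
    _ = 1 := by rw [← Finset.sum_mul, hm, one_mul]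

/-- `P_X` is antitone in the source set. [cite: VandenbergHaggstromKahn2005, §1 p. 3] -/
theorem PavN_antitone {w : Sym2 V → ℝ} (hw0 : ∀ e, 0 ≤ w e) (hw1 : ∀ e, w e ≤ 1) (U Sig : Finset V) (X : Set V)
    {N N' : Set V} (h : N ⊆ N') : PavN w U Sig X N' ≤ PavN w U Sig X N :=
  Finset.sum_le_sum fun ω _ => mul_le_mul_of_nonneg_left
    (ind_mono (avoidAll_antitone U Sig (Set.union_subset_union_right X h)) ω) (weight_nonneg hw0 hw1 ω)

/-- **Star decomposition of the event `avoidAll`** (BHK's identity (6) for several clusters avoiding a set containing `Z`).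
[cite: VandenbergHaggstromKahn2005, §1 p. 4, identity (6)] -/
theorem avoidAll_step_sum {U Z : Finset V} (hZU : Z ⊆ U) (Sig : Finset V) {W' : Set V} (hZW' : (↑Z : Set V) ⊆ W')
    (w : Sym2 V → ℝ) (hm : ∑ ω, weight w ω = 1) :
    ∑ ω, weight w ω * ind (avoidAll U Sig W') ω =
      ∑ ω, weight w ω * ∑ ω', weight w ω' * ind (avoidAll (U \ Z) Sig ((W' \ ↑Z) ∪ rS U Z ω)) ω' := by
  set A := meeting Z with hA
  set Φ : Set (Sym2 V) → Set (Sym2 V) → ℝ := fun ζ η =>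
    ind (avoidAll (U \ Z) Sig ((W' \ ↑Z) ∪ rS U Z ζ)) η with hΦ
  have h1 : ∀ ω, ind (avoidAll U Sig W') ω = Φ (ω ∩ A) (ω \ A) := by
    intro ω
    simp only [hΦ, hA, rS_inter_meeting]
    by_cases hω : ω ∈ avoidAll U Sig W'
    · rw [ind_of_mem hω, ind_of_mem ((mem_avoidAll_diff_meeting U Z Sig _ ω).2
        ((mem_avoidAll_iff_restrict hZU Sig hZW' ω).1 hω))]
    · rw [ind_of_not_mem hω, ind_of_not_mem fun h =>
        hω ((mem_avoidAll_iff_restrict hZU Sig hZW' ω).2 ((mem_avoidAll_diff_meeting U Z Sig _ ω).1 h))]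
  have h2 : ∀ ω ω', Φ (ω ∩ A) (ω' \ A) = ind (avoidAll (U \ Z) Sig ((W' \ ↑Z) ∪ rS U Z ω)) ω' := by
    intro ω ω'
    simp only [hΦ, hA, rS_inter_meeting]
    by_cases hω' : ω' ∈ avoidAll (U \ Z) Sig ((W' \ ↑Z) ∪ rS U Z ω)
    · rw [ind_of_mem hω', ind_of_mem ((mem_avoidAll_diff_meeting U Z Sig _ ω').2 hω')]
    · rw [ind_of_not_mem hω', ind_of_not_mem fun h => hω' ((mem_avoidAll_diff_meeting U Z Sig _ ω').1 h)]
  calc ∑ ω, weight w ω * ind (avoidAll U Sig W') ω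
      = (∑ ω, weight w ω) * ∑ ω, weight w ω * Φ (ω ∩ A) (ω \ A) := by rw [hm, one_mul]; simp_rw [h1]
    _ = ∑ ω, weight w ω * ∑ ω', weight w ω' * Φ (ω ∩ A) (ω' \ A) := blockFubini w A Φ
    _ = _ := by simp_rw [h2]

/-- **Star decomposition of `P_X`**: `P_U(N) = Σ_ω weight(ω)·P_{U∖Z}((N ∖ Z) ∪ S(ω))` for `Z ⊆ N`, `Z ⊆ U`.
[cite: VandenbergHaggstromKahn2005, §1 p. 4, identity (6)] -/
theorem PavN_step {U Z : Finset V} (hZU : Z ⊆ U) (Sig : Finset V) {X N : Set V} (hZN : (↑Z : Set V) ⊆ N)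
    (w : Sym2 V → ℝ) (hm : ∑ ω, weight w ω = 1) :
    PavN w U Sig X N = ∑ ω, weight w ω * PavN w (U \ Z) Sig X ((N \ ↑Z) ∪ rS U Z ω) := by
  unfold PavN
  rw [avoidAll_step_sum hZU Sig (hZN.trans Set.subset_union_right) w hm]
  refine Finset.sum_congr rfl fun ω _ => ?_
  congr 1
  refine Finset.sum_congr rfl fun ω' _ => ?_
  rw [avoidAll_eq_of_agree (U \ Z) Sig (union_diff_agree U Z X N (rS U Z ω))]

end Summit.CriticalPhenomena.PercolationContinuityZ3.Theorems.CovTau
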